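import Summits.BirchSwinnertonDyer.BirchSwinnertonDyer.Theses.BiquadraticEisensteinDescent
import Literature.NumberTheory.EllipticCurves.DeuringSupersingularReductionHoldsProofs
import Literature.NumberTheory.EllipticCurves.AnalyticRankModularityProofs
import HarnessLib

/-!
# Route `BiquadraticEisensteinDescent` — support `PublishedInputsBiquadratic` (stmt-BirchSwinnertonDyer-20243) from SEVEN
# of its eight by-name children: `EntireLFunctionRat` (19273) is implied by `NewformOfEllipticCurve` (19382)

Width seat `bsd-wall-cm-bed-w2` g5 (cell `pub/bsd-wall`, row 12), 2026-08-28; the «B8 reduce» line of the inputs planner's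
`INPUTS-LIST-1.md` (bsd-inputs-plan-1 g1, sha16 8548f98e781dcf35). The landed glue
`…Theorems.BiquadraticEisensteinDescentPublishedInputsBiquadraticOfParts.publishedInputsBiquadraticOfParts_proof` (stmt-20324)
rebuilds the eleven-conjunct support `PublishedInputsBiquadratic` from its EIGHT by-name children (Deuring's criterion,
conjunct 10, being the tree theorem `deuring_not_hasUnitRootAt_of_hasCM_of_not_cmSplit_holds`). One child more is
redundant in the kernel: conjunct 5 `WeierstrassCurve.hasEntireLFunction_rat` (child `EntireLFunctionRat`, stmt-19273) follows
from conjunct 6 `exists_isNewformOf` (child `NewformOfEllipticCurve`, stmt-19382) by the tree theorem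
`WeierstrassCurve.hasEntireLFunction_rat_of_exists_isNewformOf` (modularity Version `L` ⇒ `L(E, s)` entire via Hecke's
continuation of `L(f, s)`; Diamond–Shurman Thm. 8.8.3 / 5.10.2, proved in the tree). Hence the support holds from SEVEN
children — the route's displayed print-input surface loses one constant (a planner may re-glue 20243 over
`publishedInputsBiquadratic_of_seven` by route edit; this file opens and closes nothing).

This module imports the route file (hypotheses and conclusion ARE route decls, by name). THEOREMS ONLY (0 definitions,
0 named facts, 0 `sorry`); CONDITIONAL on the seven children as hypotheses; no published fact is proved here; BSD is not
proved by any of this. Supports stmt-BirchSwinnertonDyer-20243.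
-/

set_option autoImplicit false
-- D-0017 layout: summit = sub-problem, so `Summit.BirchSwinnertonDyer.BirchSwinnertonDyer.…` is the mandated namespace.
set_option linter.dupNamespace false

namespace Summit.BirchSwinnertonDyer.BirchSwinnertonDyer.Theorems.BiquadraticEisensteinDescentPublishedInputsBiquadraticOfPartsReduced

open Summit.BirchSwinnertonDyer.BirchSwinnertonDyer.Theses.BiquadraticEisensteinDescent

-- The implication «child 19382 `NewformOfEllipticCurve` ⇒ child 19273 `EntireLFunctionRat`» by itself is ALREADY landed (same
-- body for route `ErratumRoadFive`'s like-named decls): `Summit.BirchSwinnertonDyer.BirchSwinnertonDyer.Theorems.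
-- entireLFunctionRat_of_newformOfEllipticCurve` (Theorems/ErratumRoadFivePublishedInputsSurface.lean); it is not restated here —
-- the glue below calls the Literature theorem `WeierstrassCurve.hasEntireLFunction_rat_of_exists_isNewformOf` directly.

/-- **Support 20243 `PublishedInputsBiquadratic` from SEVEN of its eight by-name children** — the landed glue
`publishedInputsBiquadraticOfParts_proof` with its binder `EntireLFunctionRat` DISCHARGED from `NewformOfEllipticCurve`
(tree theorem `WeierstrassCurve.hasEntireLFunction_rat_of_exists_isNewformOf`: modularity Version `L` ⇒ `L(E, s)` entire) and
Deuring's conjunct from the tree theorem `deuring_not_hasUnitRootAt_of_hasCM_of_not_cmSplit_holds`. Binder order = the glue's,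
minus the third. CONDITIONAL on the seven; nothing booked. [cite: DiamondShurman2005, Thm. 8.8.3 and Thm. 5.10.2]
[cite: Lang1987, Ch. 13 §4 Thm. 12] -/
theorem publishedInputsBiquadratic_of_seven (h1 : ClassicalInputsBiquadratic) (h2 : RankEqAnalyticRankLeOne)
    (h4 : NewformOfEllipticCurve) (h5 : FriedbergHoffsteinHeegnerSplitTwist) (h6 : CMRankZeroBSDTriple)
    (h7 : EdixhovenManinNonPotOrdinary) (h8 : BSDQuotientIsogenyInvariance) : PublishedInputsBiquadratic :=
  ⟨h1.1, h1.2.1, h1.2.2, h2, WeierstrassCurve.hasEntireLFunction_rat_of_exists_isNewformOf h4, h4, h5, h6, h7,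
    Literature.NumberTheory.EllipticCurves.deuring_not_hasUnitRootAt_of_hasCM_of_not_cmSplit_holds, h8⟩

/-- The same, through the landed eight-binder glue (kernel cross-check that the reduced list feeds
`PublishedInputsBiquadraticOfParts` verbatim). [cite: DiamondShurman2005, Thm. 8.8.3] -/
theorem publishedInputsBiquadratic_of_seven' (hglue : PublishedInputsBiquadraticOfParts) (h1 : ClassicalInputsBiquadratic)
    (h2 : RankEqAnalyticRankLeOne) (h4 : NewformOfEllipticCurve) (h5 : FriedbergHoffsteinHeegnerSplitTwist)
    (h6 : CMRankZeroBSDTriple) (h7 : EdixhovenManinNonPotOrdinary) (h8 : BSDQuotientIsogenyInvariance) :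
    PublishedInputsBiquadratic :=
  hglue h1 h2 (WeierstrassCurve.hasEntireLFunction_rat_of_exists_isNewformOf h4) h4 h5 h6 h7 h8

end Summit.BirchSwinnertonDyer.BirchSwinnertonDyer.Theorems.BiquadraticEisensteinDescentPublishedInputsBiquadraticOfPartsReduced
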